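import Literature.NumberTheory.Automorphic.HeckeFixedVectorsSimple
import Literature.NumberTheory.Automorphic.HeckeAlgebraFixedPointsProofs
import Mathlib.LinearAlgebra.FiniteDimensional.Basic
import Mathlib.LinearAlgebra.Dimension.Constructions
import HarnessLib

/-!
# Gelfand pairs act through commuting Hecke operators; common eigenvectors; cyclic modules of
# Hecke eigenvectors

Topic `NumberTheory/Automorphic`; theorems only. Second algebraic layer of the proof of the
existence half of Flath's tensor product theorem (`flath_exists` of `AutomorphicGLn`; Flath,
Corvallis 1979, Thm. 3; Bump (1997), §3.4), complementing `FlathLocalLemmas`: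

* `IsGelfandPair.heckeOperator_comm_apply` — the bridge from the tree's predicate
  `IsGelfandPair k G K` ("`ℋ(G, K) = End_G(k[G ⧸ K])` is commutative", module `HeckeAlgebra`) to
  representations: for a Hecke pair, the concrete Hecke operators `[KgK] = ∑_{yK ⊆ KgK} ρ(y)`
  (`heckeOperator ρ K g`) of *every* representation `ρ` commute on the `K`-fixed vectors `V^K`.
  This is immediate from the discharged fact `exists_algHom_moduleEnd_fixedPoints`
  (`heckeAlgebra.fixedPointsAlgHom`: `V^K` is a right `ℋ(G, K)`-module in which the basis element
  of `KgK` — `exists_basis_heckeAlgebra_holds` — acts by `[KgK]`) (Cartier, Corvallis 1979, §IV.1;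
  Bump (1997), Thm. 4.6.2 for `GL_n`).
* `heckeOperator_comp_eq_of_forall_comm` — `[KgK]` commutes with every endomorphism commuting
  with `ρ(G)`.
* `exists_common_eigenvector_of_forall_comm` — a family of pairwise commuting endomorphisms
  preserving a non-zero finite-dimensional subspace `M` over an algebraically closed field has a
  common eigenvector in `M` (a minimal non-zero invariant subspace is a joint eigenspace). For Flath's
  theorem this supplies, on the finite-dimensional `W^U`, a simultaneous eigenvector of the
  commuting spherical Hecke operators at all the Gelfand places — the step where Bump (1997),
  Thm. 3.4.4 uses spherical idempotents/anti-involutions and which his Exercise 3.4.6 (p. 317) asks to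
  redo under commutativity alone, as in Flath's Thm. 2.
* `exists_eq_smul_of_mem_span_of_heckeEigenvector` — if `w ∈ V^K` is an eigenvector of every
  Hecke operator `[KgK]` (finite double cosets, characteristic `0`), then every `K`-fixed vector of
  the cyclic module `span {ρ(g) w}` is a multiple of `w` (coset-sum averaging as in
  `eq_fixedPoints_of_heckeOperator_stable`; Bump (1997), Prop. 4.2.3 and Thm. 4.6.2; Cartier §IV.1).

## References

* P. Cartier, *Representations of 𝔭-adic groups: a survey*, Proc. Sympos. Pure Math. 33 (1979),
  part 1, §IV.1 [CartierCorvallis1979].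
* D. Bump, *Automorphic forms and representations* (1997), Prop. 4.2.3, Thm. 4.6.2, §3.4 and
  Exercise 3.4.6 [Bump1997].
* D. Flath, *Decomposition of representations into tensor products*, Corvallis 1979, Thm. 2
  [FlathCorvallis1979].
-/

noncomputable section

open MulAction

namespace Literature.NumberTheory.Automorphic

/-! ### Gelfand pairs: the Hecke operators of every representation commute on `V^K` -/

section Gelfand

variable {k G V : Type*} [CommRing k] [Group G] (K : Subgroup G)
  [IsHeckeTriple (⊤ : Submonoid G) K K] [AddCommGroup V] [Module k V]

/-- **Gelfand pairs act through commuting Hecke operators.** If `(G, K)` is a Hecke pair and a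
Gelfand pair over `k` (`IsGelfandPair k G K`: `End_G(k[G ⧸ K])` is commutative), then for every
representation `ρ` of `G` the Hecke operators `[KxK]`, `[KyK]` commute on `V^K`. Proof: by
`heckeAlgebra.fixedPointsAlgHom` (discharge of `exists_algHom_moduleEnd_fixedPoints`) the
opposite algebra `ℋ(G, K)ᵐᵒᵖ` acts on `V^K` with the double-coset basis element of `KgK`
(`exists_basis_heckeAlgebra_holds`) acting by `[KgK]`; an algebra map out of a commutative algebra
has commuting values. (Cartier, Corvallis 1979, §IV.1; Bump (1997), Thm. 4.6.2.) [cite: CartierCorvallis1979, §IV.1] -/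
theorem IsGelfandPair.heckeOperator_comm_apply (h : IsGelfandPair k G K)
    (ρ : Representation k G V) (x y : G) {v : V} (hv : v ∈ ρ.fixedPoints K) :
    heckeOperator ρ K x (heckeOperator ρ K y v) = heckeOperator ρ K y (heckeOperator ρ K x v) := by
  obtain ⟨b, hb⟩ := exists_basis_heckeAlgebra_holds k G K
  set a := heckeAlgebra.fixedPointsAlgHom (k := k) K ρ with ha
  have key : ∀ (g : G) (w : ρ.fixedPoints K),
      (a (MulOpposite.op (b (HeckeCoset.mk K K ⟨g, Submonoid.mem_top g⟩))) w : V) =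
        heckeOperator ρ K g w := fun g w => by
    rw [heckeAlgebra.coe_fixedPointsAlgHom_apply, hb, heckeAlgebra.liftRep_doubleCosetIndicator]
  have h1 : (a (MulOpposite.op (b (HeckeCoset.mk K K ⟨x, Submonoid.mem_top x⟩)) *
        MulOpposite.op (b (HeckeCoset.mk K K ⟨y, Submonoid.mem_top y⟩))) ⟨v, hv⟩ : V) =
      heckeOperator ρ K x (heckeOperator ρ K y v) := by
    rw [map_mul, Module.End.mul_apply, key, key]
  have h2 : (a (MulOpposite.op (b (HeckeCoset.mk K K ⟨y, Submonoid.mem_top y⟩)) *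
        MulOpposite.op (b (HeckeCoset.mk K K ⟨x, Submonoid.mem_top x⟩))) ⟨v, hv⟩ : V) =
      heckeOperator ρ K y (heckeOperator ρ K x v) := by
    rw [map_mul, Module.End.mul_apply, key, key]
  rw [← h1, ← h2, ← MulOpposite.op_mul, ← MulOpposite.op_mul, h _ _]

end Gelfand

/-! ### Hecke operators commute with the commutant of `ρ(G)` -/

section Commute

variable {k G V : Type*} [CommRing k] [Group G] [AddCommGroup V] [Module k V]
  (ρ : Representation k G V) (K : Subgroup G)

/-- A Hecke operator `[KgK] = ∑_{yK ⊆ KgK} ρ(y)` (finite double coset) commutes with every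
`k`-linear endomorphism `T` commuting with all the `ρ(x)`, `x ∈ G`: it is a finite sum of such
operators. [folklore] -/
theorem apply_heckeOperator_eq_of_forall_comm (g : G) (hfin : (orbit K (g : G ⧸ K)).Finite)
    (T : V →ₗ[k] V) (hT : ∀ (x : G) (v : V), T (ρ x v) = ρ x (T v)) (v : V) :
    T (heckeOperator ρ K g v) = heckeOperator ρ K g (T v) := by
  classical
  unfold heckeOperator
  rw [finsum_mem_eq_finite_toFinset_sum _ hfin, LinearMap.sum_apply, LinearMap.sum_apply, map_sum]
  exact Finset.sum_congr rfl fun y _ => hT y.out v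

/-- `heckeOperator ρ K g` commutes, as an endomorphism, with the commutant of `ρ(G)` (finite
double coset). [folklore] -/
theorem heckeOperator_comp_eq_of_forall_comm (g : G) (hfin : (orbit K (g : G ⧸ K)).Finite)
    (T : V →ₗ[k] V) (hT : ∀ x : G, T ∘ₗ ρ x = ρ x ∘ₗ T) :
    T ∘ₗ heckeOperator ρ K g = heckeOperator ρ K g ∘ₗ T :=
  LinearMap.ext fun v =>
    apply_heckeOperator_eq_of_forall_comm ρ K g hfin T (fun x w => congr($(hT x) w)) v

end Commute

/-! ### Common eigenvectors of commuting endomorphisms on an invariant finite-dimensional subspace -/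

section CommonEigenvector

variable {k W : Type*} [Field k] [IsAlgClosed k] [AddCommGroup W] [Module k W]

/-- **Common eigenvector.** Let `M ≠ 0` be a finite-dimensional subspace of a `k`-vector space `W`
(`k` algebraically closed) and `𝒮` a set of endomorphisms of `W` preserving `M` and commuting
pairwise on `M`. Then some non-zero `w ∈ M` is an eigenvector of every `T ∈ 𝒮`. Proof: a non-zero
`𝒮`-invariant subspace `E ≤ M` of minimal dimension is a joint eigenspace — for `T ∈ 𝒮` an
eigenspace of `T|_E` is non-zero and `𝒮`-invariant, hence all of `E`. (Standard; the simultaneous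
eigenvector of a commutative family, cf. Bump (1997), proof of Thm. 3.4.4, p. 313: "we can find a
simultaneous eigenspace for `H_v[e_v°]`".) [folklore] -/
theorem exists_common_eigenvector_of_forall_comm (M : Submodule k W) [FiniteDimensional k M]
    (hM : M ≠ ⊥) (𝒮 : Set (W →ₗ[k] W)) (hstab : ∀ T ∈ 𝒮, ∀ m ∈ M, T m ∈ M)
    (hcomm : ∀ S ∈ 𝒮, ∀ T ∈ 𝒮, ∀ m ∈ M, S (T m) = T (S m)) :
    ∃ w ∈ M, w ≠ 0 ∧ ∀ T ∈ 𝒮, ∃ c : k, T w = c • w := by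
  classical
  let P : ℕ → Prop := fun n => ∃ E : Submodule k W, E ≤ M ∧ E ≠ ⊥ ∧
    (∀ T ∈ 𝒮, ∀ e ∈ E, T e ∈ E) ∧ Module.finrank k E = n
  have hP : ∃ n, P n := ⟨_, M, le_rfl, hM, hstab, rfl⟩
  obtain ⟨E, hEM, hE0, hE, hEn⟩ := Nat.find_spec hP
  haveI : FiniteDimensional k E := Submodule.finiteDimensional_of_le hEM
  -- every `T ∈ 𝒮` is a scalar on `E`
  have hscal : ∀ T ∈ 𝒮, ∃ c : k, ∀ e ∈ E, T e = c • e := by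
    intro T hT
    haveI : Nontrivial E := Submodule.nontrivial_iff_ne_bot.2 hE0
    let T' : Module.End k E := T.restrict fun e he => hE T hT e he
    have hT' : ∀ e : E, (T' e : W) = T e := fun e => rfl
    obtain ⟨c, hc⟩ := Module.End.exists_eigenvalue T'
    refine ⟨c, ?_⟩
    set E' : Submodule k W := E ⊓ LinearMap.ker (T - c • LinearMap.id) with hE'
    have hmem : ∀ {v : W}, v ∈ E' ↔ v ∈ E ∧ T v = c • v := by
      intro v
      rw [hE', Submodule.mem_inf, LinearMap.mem_ker, LinearMap.sub_apply, LinearMap.smul_apply,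
        LinearMap.id_apply, sub_eq_zero]
    have hE'0 : E' ≠ ⊥ := by
      obtain ⟨x, hx⟩ := hc.exists_hasEigenvector
      refine (Submodule.ne_bot_iff E').2 ⟨x, hmem.2 ⟨x.2, ?_⟩, fun h => hx.2 (Subtype.ext h)⟩
      rw [← hT', hx.apply_eq_smul, Submodule.coe_smul]
    have hE'st : ∀ S ∈ 𝒮, ∀ e ∈ E', S e ∈ E' := by
      intro S hS e he
      obtain ⟨heE, heT⟩ := hmem.1 he
      refine hmem.2 ⟨hE S hS e heE, ?_⟩
      rw [hcomm T hT S hS e (hEM heE), heT, map_smul]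
    have hle : E' ≤ E := inf_le_left
    have h1 : Nat.find hP ≤ Module.finrank k E' :=
      Nat.find_min' hP ⟨E', hle.trans hEM, hE'0, hE'st, rfl⟩
    have h2 : Module.finrank k E' ≤ Module.finrank k E := Submodule.finrank_mono hle
    have heq : E' = E := Submodule.eq_of_le_of_finrank_eq hle (le_antisymm h2 (hEn ▸ h1))
    intro e he
    have : e ∈ E' := heq ▸ he
    exact (hmem.1 this).2
  obtain ⟨w, hwE, hw0⟩ := Submodule.exists_mem_ne_zero_of_ne_bot hE0
  exact ⟨w, hEM hwE, hw0, fun T hT => (hscal T hT).imp fun c hc => hc w hwE⟩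

end CommonEigenvector

/-! ### The cyclic module of a Hecke eigenvector has a one-dimensional space of `K`-fixed vectors -/

section HeckeEigenvector

variable {k G V : Type*} [Field k] [CharZero k] [Group G] [AddCommGroup V] [Module k V]
  (ρ : Representation k G V) (K : Subgroup G)

/-- **`K`-fixed vectors of the cyclic module of a Hecke eigenvector.** Let every double coset
`KgK` be a finite union of left cosets, `k` of characteristic zero, and let `w ∈ V^K` be an
eigenvector of every Hecke operator `[KgK]`. Then every `K`-fixed vector `z` of the cyclic module
`span {ρ(g) w}` is a multiple of `w`: each `ρ(g) w` is fixed by the finite-index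
`B = K ∩ gKg⁻¹ ≤ K` and its coset sums over `K ⧸ A`, `A ≤ B`, are `[B:A] • [KgK] w ∈ k w`
(`finsum_stabilizer_apply_eq_heckeOperator`); this persists under sums and scalars, and for the
`K`-fixed `z` the coset sum over `K ⧸ B` is `[K:B] • z`. (Bump (1997), Prop. 4.2.3 and Thm. 4.6.2;
Cartier, Corvallis 1979, §IV.1: multiplicity one for spherical vectors.) [cite: Bump1997, Thm. 4.6.2] -/
theorem exists_eq_smul_of_mem_span_of_heckeEigenvector
    (hfin : ∀ g : G, (orbit K (g : G ⧸ K)).Finite) {w : V} (hwK : w ∈ ρ.fixedPoints K)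
    (heig : ∀ g : G, ∃ μ : k, heckeOperator ρ K g w = μ • w) {z : V}
    (hz : z ∈ Submodule.span k (Set.range fun g : G => ρ g w)) (hzK : z ∈ ρ.fixedPoints K) :
    ∃ c : k, z = c • w := by
  classical
  have key : ∀ u ∈ Submodule.span k (Set.range fun g : G => ρ g w),
      ∃ B : Subgroup K, B.FiniteIndex ∧
        u ∈ Representation.fixedPoints (ρ.comp K.subtype) B ∧
        ∀ A : Subgroup K, A ≤ B → A.FiniteIndex →
          ∑ᶠ c : K ⧸ A, (ρ.comp K.subtype) c.out u ∈ k ∙ w := by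
    intro u hu
    induction hu using Submodule.span_induction with
    | mem x hx =>
      obtain ⟨g, rfl⟩ := hx
      refine ⟨stabilizer K (g : G ⧸ K), finiteIndex_stabilizer K g (hfin g),
        apply_mem_fixedPoints_stabilizer ρ K g hwK, fun A hA _ => ?_⟩
      haveI := finiteIndex_stabilizer K g (hfin g)
      rw [finsum_apply_out_eq_relIndex_smul (ρ.comp K.subtype) hA
          (apply_mem_fixedPoints_stabilizer ρ K g hwK),
        finsum_stabilizer_apply_eq_heckeOperator ρ K g (hfin g) hwK]
      obtain ⟨μ, hμ⟩ := heig g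
      rw [hμ]
      exact nsmul_mem (Submodule.smul_mem _ μ (Submodule.mem_span_singleton_self w)) _
    | zero =>
      refine ⟨⊤, inferInstance, Submodule.zero_mem _, fun A _ _ => ?_⟩
      simp only [map_zero, finsum_zero]
      exact Submodule.zero_mem _
    | add x y _ _ ihx ihy =>
      obtain ⟨B₁, hB₁, hx₁, h₁⟩ := ihx
      obtain ⟨B₂, hB₂, hy₂, h₂⟩ := ihy
      refine ⟨B₁ ⊓ B₂, ⟨Subgroup.index_inf_ne_zero hB₁.index_ne_zero hB₂.index_ne_zero⟩,
        Submodule.add_mem _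
          (Representation.fixedPoints_antitone (ρ.comp K.subtype) inf_le_left hx₁)
          (Representation.fixedPoints_antitone (ρ.comp K.subtype) inf_le_right hy₂),
        fun A hA hAfi => ?_⟩
      haveI := hAfi
      letI : Fintype (K ⧸ A) := Fintype.ofFinite _
      have hx' := h₁ A (hA.trans inf_le_left) hAfi
      have hy' := h₂ A (hA.trans inf_le_right) hAfi
      rw [finsum_eq_sum_of_fintype] at hx' hy' ⊢
      simp only [map_add, Finset.sum_add_distrib]
      exact Submodule.add_mem _ hx' hy'
    | smul a x _ ih =>
      obtain ⟨B, hB, hxB, h⟩ := ih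
      refine ⟨B, hB, Submodule.smul_mem _ a hxB, fun A hA hAfi => ?_⟩
      haveI := hAfi
      letI : Fintype (K ⧸ A) := Fintype.ofFinite _
      have hx' := h A hA hAfi
      rw [finsum_eq_sum_of_fintype] at hx' ⊢
      simp only [map_smul, ← Finset.smul_sum]
      exact Submodule.smul_mem _ a hx'
  obtain ⟨B, hBfi, -, hB⟩ := key z hz
  have hzinv : z ∈ Representation.invariants (ρ.comp K.subtype) := hzK
  have hmem := hB B le_rfl hBfi
  rw [finsum_apply_out_eq_index_smul (ρ.comp K.subtype) B hzinv, ← Nat.cast_smul_eq_nsmul k]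
    at hmem
  have hidx : (B.index : k) ≠ 0 := Nat.cast_ne_zero.2 hBfi.index_ne_zero
  have hz' : z ∈ k ∙ w := by
    rw [show z = (B.index : k)⁻¹ • ((B.index : k) • z) by
      rw [smul_smul, inv_mul_cancel₀ hidx, one_smul]]
    exact Submodule.smul_mem _ _ hmem
  obtain ⟨c, hc⟩ := Submodule.mem_span_singleton.1 hz'
  exact ⟨c, hc.symm⟩

end HeckeEigenvector

end Literature.NumberTheory.Automorphic
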